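import Summits.AtomisticToContinuum.HydrodynamicLimit.Theorems.StiffCollisionalRelaxationAprioriBoundsFibreDefs
import Summits.AtomisticToContinuum.HydrodynamicLimit.Theorems.JaynesSqueezeBlockGibbsToRelEntropyLedger
import HarnessLib

/-!
# The lever `stub_deficitTransfer` of the line `fibre-deficit-transfer` (crux `AprioriBounds`,
stmt-AtomisticToContinuum-14827), part 1: the tilted reference is a local Gibbs law; the relative-entropy identity

Support file (`--supports stmt-AtomisticToContinuum-14827`) of the lead prover of the line
(`Cruxes/AprioriBounds/Lines/fibre_deficit_transfer.lean`, skeleton r2).  The line controls the law `μ_s` of the gas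
at time `s` through its relative entropy against the LOCAL GIBBS STATE TILTED BY THE ENTROPY-GRADIENT FIELD of the
classical solution, `G_s ∝ exp(∑ᵢ Λ(s,xᵢ)·(1,vᵢ,|vᵢ|²/2)) dLiouville` (`tiltPot`, `tiltZ` of the Defs file).  The key
structural remark of this part: since `Λ(s,x)·(1,v,|v|²/2) = λ₀ + ⟪u,v⟫/θ − |v|²/(2θ) = λ₀ + |u|²/(2θ) − |v−u|²/(2θ)`,
the one-particle weight `exp(Λ·(1,v,|v|²/2))` IS a local Gibbs profile `a_s(x)·M_{1,u(s,x),θ(s,x)}(v)` with the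
SLICE ACTIVITY `a_s(x) = exp(λ₀(s,x) + |u(s,x)|²/(2θ(s,x)))·(2πθ(s,x))^{3/2}` (`log_localGibbsProfile_slice`).  Hence
`G_s = localGibbsLaw σ a_s u_s θ_s N Φ`, `Z_N(Λ_s)` is its canonical partition function (`tiltZ_eq_ofReal`), the
tilt potential is `(N+1)×` the empirical log-profile pairing (`tiltPot_eq_logPair`), and the tree's exact finite-`N`
relative-entropy bookkeeping for local Gibbs references (`JaynesSqueezeClosure.toReal_klDiv_lawAt_localGibbsLaw_eq`,
Liouville invariance inside) gives the identity of the line,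

  `H(μ_s | G_s) = log Z_N(Λ_s) − S(μ₀) − (N+1)·m_s − (N+1)·E_{μ₀}[ℓ_s ∘ Φ_s]`

(`toReal_klDiv_lawAt_slice_eq`; `S(μ₀) = gibbsEntropy`, computed in `gibbsEntropy_eq`), and with the statics bound
`TiltedExcessAt` at `(N, s)` the sub-extensive estimate `H(μ_s | G_s) ≤ R − (N+1)·E_{μ₀}[ℓ_s ∘ Φ_s]`
(`toReal_klDiv_lawAt_slice_le`, the registered sub-goal of this file).

No new definitions (the slice activity is written as an explicit function); tools: `MacroClosureLine.StubLedger.*`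
(log-density bookkeeping), `JaynesSqueezeClosure.*`, `JaynesSqueezeSqueeze.*` (integrability of the kinetic pairing).
-/

noncomputable section

open MeasureTheory Filter Set Topology InformationTheory
open scoped ENNReal

namespace Summit.AtomisticToContinuum.HydrodynamicLimit.Theorems.FibreDeficitTransfer

open Literature.MathematicalPhysics.KineticTheory Literature.Analysis.FluidPDE
open Summit.AtomisticToContinuum.HydrodynamicLimit.Theorems.VisitLedgerUpscattering (Cfg Flow Flows NiceProfiles)
open MacroClosureLine.StubLedger JaynesSqueezeClosure JaynesSqueezeSqueeze

variable {σ : ℝ} {ρ θ : ℝ → T3 → ℝ} {u : ℝ → T3 → V3}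

/-! ## The slice profile -/

/-- `finrank ℝ ℝ³ = 3` in the exponent of the local Maxwellian. -/
theorem neg_finrank_V3_div_two : (-(Module.finrank ℝ V3 : ℝ) / 2) = -(3 / 2 : ℝ) := by
  rw [finrank_euclideanSpace_fin]
  norm_num

/-- The slice activity `a_s(x) = exp(λ₀ + |u|²/(2θ))·(2πθ)^{3/2}` is positive (for `θ > 0`). -/
theorem sliceAct_pos (s : ℝ) (x : T3) (hθ : 0 < θ s x) :
    0 < Real.exp (lam0 σ (ρ s x) (θ s x) (u s x) + ‖u s x‖ ^ 2 / (2 * θ s x)) *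
      (2 * Real.pi * θ s x) ^ ((3 : ℝ) / 2) :=
  mul_pos (Real.exp_pos _) (Real.rpow_pos_of_pos (mul_pos (mul_pos two_pos Real.pi_pos) hθ) _)

/-- The slice activity is continuous in `x` when the slice fields and the density multiplier are. -/
theorem continuous_sliceAct (s : ℝ) (hθc : Continuous (θ s)) (huc : Continuous (u s)) (hθ : ∀ x, 0 < θ s x)
    (hΛ : Continuous fun x => lam0 σ (ρ s x) (θ s x) (u s x)) :
    Continuous fun x => Real.exp (lam0 σ (ρ s x) (θ s x) (u s x) + ‖u s x‖ ^ 2 / (2 * θ s x)) *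
      (2 * Real.pi * θ s x) ^ ((3 : ℝ) / 2) := by
  refine (hΛ.add ((huc.norm.pow 2).div (continuous_const.mul hθc) fun x =>
    mul_ne_zero two_ne_zero (hθ x).ne')).rexp.mul ?_
  exact (continuous_const.mul hθc).rpow_const fun x => Or.inl (mul_pos (mul_pos two_pos Real.pi_pos) (hθ x)).ne'

/-- **The tilt exponent is the log of a local Gibbs profile**: with the slice activity `a_s`,
`log (a_s(x) M_{1,u(s,x),θ(s,x)}(v)) = Λ(s,x)·(1, v, |v|²/2)`. -/
theorem log_localGibbsProfile_slice (s : ℝ) (hθ : ∀ x, 0 < θ s x) (y : T3 × V3) :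
    Real.log (localGibbsProfile (fun x => Real.exp (lam0 σ (ρ s x) (θ s x) (u s x) + ‖u s x‖ ^ 2 / (2 * θ s x)) *
        (2 * Real.pi * θ s x) ^ ((3 : ℝ) / 2)) (u s) (θ s) y) = tiltExponent σ ρ θ u s y := by
  obtain ⟨x, v⟩ := y
  have h2πθ : 0 < 2 * Real.pi * θ s x := mul_pos (mul_pos two_pos Real.pi_pos) (hθ x)
  rw [log_localGibbsProfile_eq x v (sliceAct_pos s x (hθ x)) (hθ x), neg_finrank_V3_div_two,
    Real.log_mul (Real.exp_pos _).ne' (Real.rpow_pos_of_pos h2πθ _).ne', Real.log_exp,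
    Real.log_rpow h2πθ, Real.log_rpow h2πθ, tiltExponent_eq_sq s (x, v) (hθ x).ne']
  ring

/-- The tilt potential is `(N+1)×` the empirical log-profile pairing of the slice profile. -/
theorem tiltPot_eq_logPair (s : ℝ) (hθ : ∀ x, 0 < θ s x) {N : ℕ} (w : Cfg N) :
    tiltPot σ ρ θ u s w = ((N : ℝ) + 1) *
      ∫ y, Real.log (localGibbsProfile (fun x => Real.exp (lam0 σ (ρ s x) (θ s x) (u s x) +
        ‖u s x‖ ^ 2 / (2 * θ s x)) * (2 * Real.pi * θ s x) ^ ((3 : ℝ) / 2)) (u s) (θ s) y) ∂(empiricalMeasure w) := by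
  rw [logPair_eq_sum, ← mul_assoc, mul_inv_cancel₀ (by positivity), one_mul, tiltPot]
  exact Finset.sum_congr rfl fun i _ => (log_localGibbsProfile_slice s hθ (w i)).symm

/-- The linear statistic is the log-profile pairing of the slice profile centred at the Euler mean. -/
theorem linStat_eq_logPair (s : ℝ) (hθ : ∀ x, 0 < θ s x) {N : ℕ} (w : Cfg N) :
    linStat σ ρ θ u s w =
      (∫ y, Real.log (localGibbsProfile (fun x => Real.exp (lam0 σ (ρ s x) (θ s x) (u s x) +
        ‖u s x‖ ^ 2 / (2 * θ s x)) * (2 * Real.pi * θ s x) ^ ((3 : ℝ) / 2)) (u s) (θ s) y) ∂(empiricalMeasure w)) -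
        tiltMean σ ρ θ u s := by
  rw [linStat]
  congr 1
  exact integral_congr_ae (ae_of_all _ fun y => (log_localGibbsProfile_slice s hθ y).symm)

/-- `exp` of the tilt potential is the tensor power of the slice profile. -/
theorem exp_tiltPot_eq_tensorPow (s : ℝ) (hθ : ∀ x, 0 < θ s x) {N : ℕ} (w : Cfg N) :
    Real.exp (tiltPot σ ρ θ u s w) =
      tensorPow (N + 1) (localGibbsProfile (fun x => Real.exp (lam0 σ (ρ s x) (θ s x) (u s x) +
        ‖u s x‖ ^ 2 / (2 * θ s x)) * (2 * Real.pi * θ s x) ^ ((3 : ℝ) / 2)) (u s) (θ s)) w := by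
  rw [tiltPot, Real.exp_sum, tensorPow]
  refine Finset.prod_congr rfl fun i _ => ?_
  rw [← log_localGibbsProfile_slice s hθ (w i), Real.exp_log]
  exact localGibbsProfile_pos (fun x => sliceAct_pos s x (hθ x)) hθ (w i)

/-- **`Z_N(Λ_s)` is the canonical partition function of the slice profile.** -/
theorem tiltZ_eq_ofReal (s : ℝ) (hθc : Continuous (θ s)) (huc : Continuous (u s)) (hθ : ∀ x, 0 < θ s x)
    (hΛ : Continuous fun x => lam0 σ (ρ s x) (θ s x) (u s x)) (N : ℕ) :
    tiltZ σ ρ θ u N s = ENNReal.ofReal (canonicalPartition (Torus.geometry (Fin 3)) (hsDiameter σ N) (N + 1)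
      (localGibbsProfile (fun x => Real.exp (lam0 σ (ρ s x) (θ s x) (u s x) + ‖u s x‖ ^ 2 / (2 * θ s x)) *
        (2 * Real.pi * θ s x) ^ ((3 : ℝ) / 2)) (u s) (θ s))) := by
  set a : T3 → ℝ := fun x => Real.exp (lam0 σ (ρ s x) (θ s x) (u s x) + ‖u s x‖ ^ 2 / (2 * θ s x)) *
    (2 * Real.pi * θ s x) ^ ((3 : ℝ) / 2) with ha_def
  have hac : Continuous a := continuous_sliceAct s hθc huc hθ hΛ
  have ha0 : ∀ x, 0 ≤ a x := fun x => (sliceAct_pos s x (hθ x)).le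
  rw [canonicalPartition_eq_posPartition hac hθc huc ha0 hθ, ofReal_posPartition hac ha0]
  have h := lintegral_gibbsWeight_mul hac hθc huc ha0 hθ (hsDiameter σ N) (N + 1) (G := fun _ => 1) measurable_const
  simp only [mul_one, lintegral_const, measure_univ] at h
  rw [← h, tiltZ, liou, liouville_eq, ← lintegral_indicator (measurableSet_hardSphereDomain _ Torus.measurable_geometry_sepVec _ _)]
  refine lintegral_congr fun w => ?_
  by_cases hw : w ∈ hardSphereDomain (Torus.geometry (Fin 3)) (N + 1) (hsDiameter σ N)
  · rw [indicator_of_mem hw, indicator_of_mem hw, exp_tiltPot_eq_tensorPow s hθ w]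
  · rw [indicator_of_notMem hw, indicator_of_notMem hw, ENNReal.ofReal_zero]

/-! ## The Gibbs entropy of the local Gibbs law -/

/-- **The Gibbs entropy of the local Gibbs law**: `S(μ₀) = log Z₀ − (N+1)·E_{μ₀}⟨emp, log prof₀⟩`
(nice profiles, `σ ≤ 1/2`; on the hard-core domain the density is `Z₀⁻¹∏ prof₀(zᵢ) > 0`). -/
theorem gibbsEntropy_eq {a₀ θ₀ : T3 → ℝ} {u₀ : T3 → V3} (ha : Continuous a₀) (hθ : Continuous θ₀)
    (hu : Continuous u₀) (ha0 : ∀ x, 0 < a₀ x) (hθ0 : ∀ x, 0 < θ₀ x) (hσ2 : σ ≤ 1 / 2) (N : ℕ) (Φ : Flow σ N) :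
    gibbsEntropy σ a₀ u₀ θ₀ N =
      Real.log (canonicalPartition (Torus.geometry (Fin 3)) (hsDiameter σ N) (N + 1) (localGibbsProfile a₀ u₀ θ₀)) -
        ((N : ℝ) + 1) * ∫ z, (∫ y, Real.log (localGibbsProfile a₀ u₀ θ₀ y) ∂(empiricalMeasure z))
          ∂(localGibbsLaw σ a₀ u₀ θ₀ N Φ) := by
  haveI := isProbabilityMeasure_localGibbsLaw ha hθ hu ha0 hθ0 hσ2 N Φ
  set Z₀ := canonicalPartition (Torus.geometry (Fin 3)) (hsDiameter σ N) (N + 1) (localGibbsProfile a₀ u₀ θ₀) with hZ₀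
  set W : Cfg N → ℝ := fun z => Z₀⁻¹ * tensorPow (N + 1) (localGibbsProfile a₀ u₀ θ₀) z with hW
  have hWpos : ∀ z, 0 < W z := gibbsDensity_pos hσ2 N ha hθ hu ha0 hθ0
  have hWm : Measurable W := measurable_gibbsDensity σ N ha hθ hu
  have hD : MeasurableSet (hardSphereDomain (Torus.geometry (Fin 3)) (N + 1) (hsDiameter σ N)) :=
    measurableSet_hardSphereDomain _ Torus.measurable_geometry_sepVec _ _
  -- the density against Liouville: `dens = W` on the hard-core domain, `0` off it
  have hdens : ∀ z, dens σ a₀ u₀ θ₀ N z =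
      (hardSphereDomain (Torus.geometry (Fin 3)) (N + 1) (hsDiameter σ N)).indicator W z := by
    intro z
    rw [hW, Set.indicator_mul_right]
    rfl
  -- `∫ dens log dens dliou = ∫ log dens dμ₀`
  have hlaw : localGibbsLaw σ a₀ u₀ θ₀ N Φ = (liou σ N).withDensity fun z => ENNReal.ofReal (dens σ a₀ u₀ θ₀ N z) := by
    rw [localGibbsLaw, particleLaw_eq]
  have hdensm : Measurable (dens σ a₀ u₀ θ₀ N) :=
    measurable_canonicalDensity _ _ (measurable_localGibbsProfile ha hθ hu)
  have hnn : ∀ z, 0 ≤ dens σ a₀ u₀ θ₀ N z := fun z => by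
    rw [hdens]
    exact Set.indicator_nonneg (fun w _ => (hWpos w).le) z
  have h1 : ∫ z, Real.log (dens σ a₀ u₀ θ₀ N z) ∂(localGibbsLaw σ a₀ u₀ θ₀ N Φ) =
      ∫ z, dens σ a₀ u₀ θ₀ N z * Real.log (dens σ a₀ u₀ θ₀ N z) ∂(liou σ N) := by
    rw [hlaw]
    have hf : (fun z => ENNReal.ofReal (dens σ a₀ u₀ θ₀ N z)) = fun z => ((dens σ a₀ u₀ θ₀ N z).toNNReal : ℝ≥0∞) :=
      rfl
    rw [hf, integral_withDensity_eq_integral_smul hdensm.real_toNNReal]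
    refine integral_congr_ae (ae_of_all _ fun z => ?_)
    dsimp only
    rw [NNReal.smul_def, Real.coe_toNNReal _ (hnn z), smul_eq_mul]
  -- on the support of `μ₀` the log-density is the affine function of the log-profile pairing
  have hae : ∀ᵐ z ∂(localGibbsLaw σ a₀ u₀ θ₀ N Φ), Real.log (dens σ a₀ u₀ θ₀ N z) =
      ((N : ℝ) + 1) * (∫ y, Real.log (localGibbsProfile a₀ u₀ θ₀ y) ∂(empiricalMeasure z)) - Real.log Z₀ := by
    have hsupp : ∀ᵐ z ∂(localGibbsLaw σ a₀ u₀ θ₀ N Φ), z ∈ hardSphereDomain (Torus.geometry (Fin 3)) (N + 1) (hsDiameter σ N) := by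
      rw [hlaw]
      refine (withDensity_absolutelyContinuous _ _).ae_le ?_
      rw [liou, liouville_eq]
      exact ae_restrict_mem hD
    filter_upwards [hsupp] with z hz
    rw [hdens, indicator_of_mem hz, hW]
    exact log_gibbsDensity hσ2 N ha hθ hu ha0 hθ0 z
  have hint : Integrable (fun z => ∫ y, Real.log (localGibbsProfile a₀ u₀ θ₀ y) ∂(empiricalMeasure z))
      (localGibbsLaw σ a₀ u₀ θ₀ N Φ) :=
    integrable_logPair_comp ha hθ hu ha0 hθ0 measurable_id (integrable_kineticPair_localGibbsLaw hσ2 ha hθ hu ha0 hθ0 N Φ)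
  rw [gibbsEntropy, ← h1, integral_congr_ae hae, integral_sub (hint.const_mul _) (integrable_const _), integral_const_mul,
    integral_const, probReal_univ, one_smul]
  ring

/-! ## The relative-entropy identity against the tilted reference -/

/-- **The identity of the line.**  For `0 < σ < 1/2`, nice profiles, a flow `Φ`, a time `s`, slice fields `u(s,·)`,
`θ(s,·) > 0` continuous and a continuous density multiplier along them, with `G_s` the local Gibbs law of the slice
profile:  `H(μ_s | G_s) = log Z_N(Λ_s) − S(μ₀) − (N+1)·m_s − (N+1)·E_{μ₀}[ℓ_s ∘ Φ_s]`  (all terms genuine: the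
relative entropy is finite, `JaynesSqueezeClosure.klDiv_lawAt_localGibbsLaw_ne_top`). -/
theorem toReal_klDiv_lawAt_slice_eq {a₀ θ₀ : T3 → ℝ} {u₀ : T3 → V3} (ha : Continuous a₀) (hθ₀ : Continuous θ₀)
    (hu₀ : Continuous u₀) (ha0 : ∀ x, 0 < a₀ x) (hθ0 : ∀ x, 0 < θ₀ x) (hσ : 0 < σ) (hσ2 : σ < 1 / 2) (N : ℕ)
    (Φ : Flow σ N) (s : ℝ) (hθc : Continuous (θ s)) (huc : Continuous (u s)) (hθ : ∀ x, 0 < θ s x)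
    (hΛ : Continuous fun x => lam0 σ (ρ s x) (θ s x) (u s x)) :
    (klDiv (Φ.lawAt (localGibbsLaw σ a₀ u₀ θ₀ N Φ) s)
        (localGibbsLaw σ (fun x => Real.exp (lam0 σ (ρ s x) (θ s x) (u s x) + ‖u s x‖ ^ 2 / (2 * θ s x)) *
          (2 * Real.pi * θ s x) ^ ((3 : ℝ) / 2)) (u s) (θ s) N Φ)).toReal =
      Real.log (tiltZ σ ρ θ u N s).toReal - gibbsEntropy σ a₀ u₀ θ₀ N - ((N : ℝ) + 1) * tiltMean σ ρ θ u s -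
        ((N : ℝ) + 1) * ∫ z, linStat σ ρ θ u s (Φ.flow s z) ∂(localGibbsLaw σ a₀ u₀ θ₀ N Φ) := by
  have hσ2' : σ ≤ 1 / 2 := hσ2.le
  have hσ2'' : σ < 2⁻¹ := by rw [← one_div]; exact hσ2
  haveI := isProbabilityMeasure_localGibbsLaw ha hθ₀ hu₀ ha0 hθ0 hσ2' N Φ
  set a : T3 → ℝ := fun x => Real.exp (lam0 σ (ρ s x) (θ s x) (u s x) + ‖u s x‖ ^ 2 / (2 * θ s x)) *
    (2 * Real.pi * θ s x) ^ ((3 : ℝ) / 2) with ha_def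
  have hac : Continuous a := continuous_sliceAct s hθc huc hθ hΛ
  have hapos : ∀ x, 0 < a x := fun x => sliceAct_pos s x (hθ x)
  rw [toReal_klDiv_lawAt_localGibbsLaw_eq hσ hσ2'' ha hθ₀ hu₀ ha0 hθ0 hac hθc huc hapos hθ N Φ s,
    gibbsEntropy_eq ha hθ₀ hu₀ ha0 hθ0 hσ2' N Φ, tiltZ_eq_ofReal s hθc huc hθ hΛ N,
    ENNReal.toReal_ofReal (canonicalPartition_localGibbs_pos hσ2' N hac hθc huc hapos hθ).le]
  -- the pairing of the slice profile through the flow is `ℓ_s ∘ Φ_s + m_s`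
  have hpair : ∀ z, (∫ y, Real.log (localGibbsProfile a (u s) (θ s) y) ∂(empiricalMeasure (Φ.flow s z))) =
      linStat σ ρ θ u s (Φ.flow s z) + tiltMean σ ρ θ u s := fun z => by
    rw [linStat_eq_logPair s hθ (Φ.flow s z)]
    ring
  have hint : Integrable (fun z => ∫ y, Real.log (localGibbsProfile a (u s) (θ s) y) ∂(empiricalMeasure (Φ.flow s z)))
      (localGibbsLaw σ a₀ u₀ θ₀ N Φ) :=
    integrable_logPair_comp hac hθc huc hapos hθ (Φ.measurable_flow s)
      (integrable_kineticPair_flow_localGibbsLaw hσ2' ha hθ₀ hu₀ ha0 hθ0 N Φ s)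
  have hintℓ : Integrable (fun z => linStat σ ρ θ u s (Φ.flow s z)) (localGibbsLaw σ a₀ u₀ θ₀ N Φ) := by
    have h : (fun z => linStat σ ρ θ u s (Φ.flow s z)) =
        fun z => (∫ y, Real.log (localGibbsProfile a (u s) (θ s) y) ∂(empiricalMeasure (Φ.flow s z))) - tiltMean σ ρ θ u s :=
      funext fun z => by rw [hpair z]; ring
    rw [h]
    exact hint.sub (integrable_const _)
  simp_rw [hpair]
  rw [integral_add hintℓ (integrable_const _), integral_const, probReal_univ, one_smul]
  ring

/-- **Integrability of the linear statistic through the flow** under the local Gibbs law (it is an affine function of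
the log-profile pairing of the slice profile, dominated by the conserved kinetic energy). -/
theorem integrable_linStat_flow {a₀ θ₀ : T3 → ℝ} {u₀ : T3 → V3} (ha : Continuous a₀) (hθ₀ : Continuous θ₀)
    (hu₀ : Continuous u₀) (ha0 : ∀ x, 0 < a₀ x) (hθ0 : ∀ x, 0 < θ₀ x) (hσ2 : σ ≤ 1 / 2) (N : ℕ)
    (Φ : Flow σ N) (s : ℝ) (hθc : Continuous (θ s)) (huc : Continuous (u s)) (hθ : ∀ x, 0 < θ s x)
    (hΛ : Continuous fun x => lam0 σ (ρ s x) (θ s x) (u s x)) :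
    Integrable (fun z => linStat σ ρ θ u s (Φ.flow s z)) (localGibbsLaw σ a₀ u₀ θ₀ N Φ) := by
  haveI := isProbabilityMeasure_localGibbsLaw ha hθ₀ hu₀ ha0 hθ0 hσ2 N Φ
  have hac := continuous_sliceAct s hθc huc hθ hΛ
  have hapos : ∀ x, 0 < Real.exp (lam0 σ (ρ s x) (θ s x) (u s x) + ‖u s x‖ ^ 2 / (2 * θ s x)) *
      (2 * Real.pi * θ s x) ^ ((3 : ℝ) / 2) := fun x => sliceAct_pos s x (hθ x)
  have hint := integrable_logPair_comp hac hθc huc hapos hθ (Φ.measurable_flow s)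
    (integrable_kineticPair_flow_localGibbsLaw hσ2 ha hθ₀ hu₀ ha0 hθ0 N Φ s)
  refine (hint.sub (integrable_const (tiltMean σ ρ θ u s))).congr (ae_of_all _ fun z => ?_)
  simp only [Pi.sub_apply]
  rw [linStat_eq_logPair s hθ (Φ.flow s z)]

/-- **The sub-extensive bound** (registered sub-goal of this file).  If at `(N, s)` the statics bound
`Z_N(Λ_s) ≤ exp(S(μ₀) + (N+1)m_s + R)` holds, then `H(μ_s | G_s) ≤ R − (N+1)·E_{μ₀}[ℓ_s ∘ Φ_s]`. -/
theorem toReal_klDiv_lawAt_slice_le : ∀ (σ : ℝ) (a₀ θ₀ : T3 → ℝ) (u₀ : T3 → V3) (ρ θ : ℝ → T3 → ℝ) (u : ℝ → T3 → V3) (N : ℕ) (Φ : HardSphereFlow (Torus.geometry (Fin 3)) (hsDiameter σ N) (N + 1)) (s R : ℝ), 0 < σ → σ < 1 / 2 → NiceProfiles a₀ θ₀ u₀ → Continuous (θ s) → Continuous (u s) → (∀ x, 0 < θ s x) → (Continuous fun x => lam0 σ (ρ s x) (θ s x) (u s x)) → tiltZ σ ρ θ u N s ≤ ENNReal.ofReal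 (Real.exp (gibbsEntropy σ a₀ u₀ θ₀ N + ((N : ℝ) + 1) * tiltMean σ ρ θ u s + R)) → (klDiv (Φ.lawAt (localGibbsLaw σ a₀ u₀ θ₀ N Φ) s) (localGibbsLaw σ (fun x => Real.exp (lam0 σ (ρ s x) (θ s x) (u s x) + ‖u s x‖ ^ 2 / (2 * θ s x)) * (2 * Real.pi * θ s x) ^ ((3 : ℝ) / 2)) (u s) (θ s) N Φ)).toReal ≤ R - ((N : ℝ) + 1) * ∫ z, linStat σ ρ θ u s (Φ.flow s z) ∂(localGibbsLaw σ a₀ u₀ θ₀ N Φ) := by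
  intro σ a₀ θ₀ u₀ ρ θ u N Φ s R hσ hσ2 hP hθc huc hθ hΛ hZ
  obtain ⟨ha, hθ₀, hu₀, ha0, hθ0⟩ := hP
  rw [toReal_klDiv_lawAt_slice_eq ha hθ₀ hu₀ ha0 hθ0 hσ hσ2 N Φ s hθc huc hθ hΛ]
  -- `log Z ≤ S + (N+1) m + R` from the statics bound (`Z > 0`)
  have hac := continuous_sliceAct s hθc huc hθ hΛ
  have hapos : ∀ x, 0 < Real.exp (lam0 σ (ρ s x) (θ s x) (u s x) + ‖u s x‖ ^ 2 / (2 * θ s x)) *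
      (2 * Real.pi * θ s x) ^ ((3 : ℝ) / 2) := fun x => sliceAct_pos s x (hθ x)
  have hZpos : 0 < (tiltZ σ ρ θ u N s).toReal := by
    rw [tiltZ_eq_ofReal s hθc huc hθ hΛ N, ENNReal.toReal_ofReal (canonicalPartition_localGibbs_pos hσ2.le N hac hθc huc hapos hθ).le]
    exact canonicalPartition_localGibbs_pos hσ2.le N hac hθc huc hapos hθ
  have hZtop : tiltZ σ ρ θ u N s ≠ ⊤ := by rw [tiltZ_eq_ofReal s hθc huc hθ hΛ N]; exact ENNReal.ofReal_ne_top
  have hlog : Real.log (tiltZ σ ρ θ u N s).toReal ≤ gibbsEntropy σ a₀ u₀ θ₀ N + ((N : ℝ) + 1) * tiltMean σ ρ θ u s + R := by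
    rw [Real.log_le_iff_le_exp hZpos]
    have h := ENNReal.toReal_mono ENNReal.ofReal_ne_top hZ
    rwa [ENNReal.toReal_ofReal (Real.exp_pos _).le] at h
  have _ := hZtop
  linarith

end Summit.AtomisticToContinuum.HydrodynamicLimit.Theorems.FibreDeficitTransfer

end
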